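import Summits.CriticalPhenomena.PercolationContinuityZ3.Theorems.Transplant.FKConnectivityAllQAntipodalMinorGluing
import HarnessLib

/-!
# Connectivity correlation inequalities for `φ_{w,q}` — file 71a: half-edges of the SUBDIVIDED TWO-TERMINAL DUAL of a
# series–parallel network (bookkeeping for file 71b)

Support file (`--supports stmt-CriticalPhenomena-4575`), FK sub-lane `prim-bschramm-fk-2` (gen 31) of the post-continuity
programme; builds on p205010 (kernel theorem, internal audit signed; external expert review pending).  No definitions, no named
facts, no sorries; standard axioms.

The sibling file 71b (`…SPDual.lean`) builds, for a two-terminal series–parallel network `E` on `V`, a dual network on the vertex type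
`Finset (Sym2 V) ⊕ Sym2 V` ("faces ⊕ subdivision points") in which the dual of the edge `e` is the 2-path
`inl (φ e) – inr e – inl (ψ e)` through the subdivision point `inr e` (`φ e` / `ψ e` = the face above / below `e`); the lower half is
kept open in every dual configuration, so the dual host is a SIMPLE graph although the planar dual of a series pair is a parallel pair.
This file is the bookkeeping of these half-edges `s(inl (φ e), inr e)` (upper) and `s(inr e, inl (ψ e))` (lower):
* `FK.eq_of_reachable_singleton` — in a one-edge configuration a vertex off the edge is joined only to itself;
* `FK.glue_parallel_finset`, `FK.glue_series_finset` — the tree's gluing laws `clusterCount_parallel/series`, `reachable_parallel/series_iff`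
  (file 9b) with the vertex sets "vertices on an edge of `Xᵢ`", in the `Finset` form used on both the primal and the dual side;
* `FK.dual_arith_series`, `FK.dual_arith_parallel` — the integer bookkeeping of the two inductive steps of the cluster-count identity;
* `FK.mem_dualEdges`, `FK.disjoint_dualEdges` (half-edges over disjoint edge sets are distinct), `FK.dual_vertex_cases` (every vertex of a
  dual configuration with terminal labels `U, D` is `inl U`, `inl D`, the label of a nonempty subset of `E`, or a subdivision point),
  `FK.dual_common_vertex` (two dual parts over disjoint edge sets meet only in terminal labels), `FK.inl_not_mem_dualEdges`,
  `FK.dual_split` (a dual configuration of `E₁ ∪ E₂` with the combined face maps splits along the parts), `FK.sdiff_union_inter`.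
[cite: Grimmett2006, §6.1 eq. (6.3) (p. 133); §3.9 (pp. 63–64)] [folklore: Duffin 1965, §4]
-/

noncomputable section

namespace Summit.CriticalPhenomena.PercolationContinuityZ3.Theorems

namespace FK

open SimpleGraph Literature.Probability.LatticeModels Literature.Probability.Percolation
open scoped Classical

variable {V : Type*}


/-! ### Small reachability facts and the two gluing laws in `Finset` form -/

/-- In a one-edge configuration `{pq}` a vertex off the edge is joined only to itself. [folklore] -/
theorem eq_of_reachable_singleton {p q u v : V} (hup : u ≠ p) (huq : u ≠ q)
    (h : (openGraph ({s(p, q)} : BondConfig V)).Reachable u v) : u = v := by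
  rw [reachable_iff_reflTransGen] at h
  rcases h.cases_head with rfl | ⟨c, hadj, _⟩
  · rfl
  · exfalso
    rw [openGraph_adj, Set.mem_singleton_iff, Sym2.eq_iff] at hadj
    rcases hadj.1 with ⟨h1, _⟩ | ⟨h1, _⟩
    · exact hup h1
    · exact huq h1

/-- **Parallel gluing law, `Finset` form** (`clusterCount_parallel` + `reachable_parallel_iff` of file 9b with the vertex sets
"vertices on an edge of `Xᵢ`"). [cite: Grimmett2006, §3.9 (pp. 63–64)] -/
theorem glue_parallel_finset [Fintype V] {X₁ X₂ d₁ d₂ : Finset (Sym2 V)} {p q : V}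
    (hsep : ∀ z : V, (∃ x ∈ X₁, z ∈ x) → (∃ x ∈ X₂, z ∈ x) → z = p ∨ z = q) (hpq : p ≠ q) (h₁ : d₁ ⊆ X₁) (h₂ : d₂ ⊆ X₂) :
    (clusterCount ((↑d₁ ∪ ↑d₂ : BondConfig V)) ∅ + Fintype.card V = clusterCount (↑d₁ : BondConfig V) ∅ + clusterCount (↑d₂ : BondConfig V) ∅
        + (if (openGraph (↑d₁ : BondConfig V)).Reachable p q ∧ (openGraph (↑d₂ : BondConfig V)).Reachable p q then 1 else 0))
      ∧ ((openGraph ((↑d₁ ∪ ↑d₂ : BondConfig V))).Reachable p q ↔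
          (openGraph (↑d₁ : BondConfig V)).Reachable p q ∨ (openGraph (↑d₂ : BondConfig V)).Reachable p q) := by
  have g₁ : ∀ e ∈ (↑X₁ : Set (Sym2 V)), ∀ z ∈ e, z ∈ {z : V | ∃ x ∈ X₁, z ∈ x} := fun e he z hz => ⟨e, he, hz⟩
  have g₂ : ∀ e ∈ (↑X₂ : Set (Sym2 V)), ∀ z ∈ e, z ∈ {z : V | ∃ x ∈ X₂, z ∈ x} := fun e he z hz => ⟨e, he, hz⟩
  have gS : {z : V | ∃ x ∈ X₁, z ∈ x} ∩ {z : V | ∃ x ∈ X₂, z ∈ x} ⊆ ({p, q} : Set V) := fun z hz => by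
    rcases hsep z hz.1 hz.2 with h | h
    · exact Or.inl h
    · exact Or.inr h
  exact ⟨clusterCount_parallel g₁ g₂ gS (Finset.coe_subset.2 h₁) (Finset.coe_subset.2 h₂) hpq,
    reachable_parallel_iff g₁ g₂ gS (Finset.coe_subset.2 h₁) (Finset.coe_subset.2 h₂)⟩

/-- **Series gluing law, `Finset` form** (`clusterCount_series` + `reachable_series_iff` of file 9b). [cite: Grimmett2006, §3.9 (pp. 63–64)] -/
theorem glue_series_finset [Fintype V] {X₁ X₂ d₁ d₂ : Finset (Sym2 V)} {p m q : V}
    (hsep : ∀ z : V, (∃ x ∈ X₁, z ∈ x) → (∃ x ∈ X₂, z ∈ x) → z = m) (hp : ∀ x ∈ X₂, p ∉ x) (hq : ∀ x ∈ X₁, q ∉ x)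
    (hpm : p ≠ m) (hqm : q ≠ m) (hpq : p ≠ q) (h₁ : d₁ ⊆ X₁) (h₂ : d₂ ⊆ X₂) :
    (clusterCount ((↑d₁ ∪ ↑d₂ : BondConfig V)) ∅ + Fintype.card V = clusterCount (↑d₁ : BondConfig V) ∅ + clusterCount (↑d₂ : BondConfig V) ∅)
      ∧ ((openGraph ((↑d₁ ∪ ↑d₂ : BondConfig V))).Reachable p q ↔
          (openGraph (↑d₁ : BondConfig V)).Reachable p m ∧ (openGraph (↑d₂ : BondConfig V)).Reachable m q) := by
  have g₁ : ∀ e ∈ (↑X₁ : Set (Sym2 V)), ∀ z ∈ e, z ∈ {z : V | ∃ x ∈ X₁, z ∈ x} := fun e he z hz => ⟨e, he, hz⟩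
  have g₂ : ∀ e ∈ (↑X₂ : Set (Sym2 V)), ∀ z ∈ e, z ∈ {z : V | ∃ x ∈ X₂, z ∈ x} := fun e he z hz => ⟨e, he, hz⟩
  have gS : {z : V | ∃ x ∈ X₁, z ∈ x} ∩ {z : V | ∃ x ∈ X₂, z ∈ x} ⊆ ({m} : Set V) := fun z hz => hsep z hz.1 hz.2
  exact ⟨clusterCount_series g₁ g₂ gS (Finset.coe_subset.2 h₁) (Finset.coe_subset.2 h₂),
    reachable_series_iff g₁ g₂ gS (Finset.coe_subset.2 h₁) (Finset.coe_subset.2 h₂) (fun ⟨x, hx, hz⟩ => hp x hx hz)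
      (fun ⟨x, hx, hz⟩ => hq x hx hz) hpm hqm hpq⟩

set_option linter.unusedSimpArgs false in
/-- Bookkeeping of the step "series in `V`, parallel in the dual". [folklore] -/
theorem dual_arith_series {r₁ r₂ : Prop} [Decidable r₁] [Decidable r₂] {kW k₁ k₂ kV kv₁ kv₂ cW cV n₁ n₂ : ℕ} {c₁ c₂ : ℤ}
    (eW : kW + cW = k₁ + k₂ + (if ¬ r₁ ∧ ¬ r₂ then 1 else 0)) (eV : kV + cV = kv₁ + kv₂)
    (e₁ : (k₁ : ℤ) = c₁ + kv₁ + n₁ + (if r₁ then 1 else 0)) (e₂ : (k₂ : ℤ) = c₂ + kv₂ + n₂ + (if r₂ then 1 else 0)) :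
    (kW : ℤ) = (c₁ + c₂ - cW + cV + 1) + kV + ((n₁ + n₂ : ℕ) : ℤ) + (if r₁ ∧ r₂ then 1 else 0) := by
  by_cases h₁ : r₁ <;> by_cases h₂ : r₂ <;> simp only [h₁, h₂, not_true_eq_false, not_false_eq_true, and_self, and_true,
    and_false, true_and, false_and, if_true, if_false] at eW e₁ e₂ ⊢ <;> push_cast <;> omega

set_option linter.unusedSimpArgs false in
/-- Bookkeeping of the step "parallel in `V`, series in the dual". [folklore] -/
theorem dual_arith_parallel {r₁ r₂ : Prop} [Decidable r₁] [Decidable r₂] {kW k₁ k₂ kV kv₁ kv₂ cW cV n₁ n₂ : ℕ} {c₁ c₂ : ℤ}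
    (eW : kW + cW = k₁ + k₂) (eV : kV + cV = kv₁ + kv₂ + (if r₁ ∧ r₂ then 1 else 0))
    (e₁ : (k₁ : ℤ) = c₁ + kv₁ + n₁ + (if r₁ then 1 else 0)) (e₂ : (k₂ : ℤ) = c₂ + kv₂ + n₂ + (if r₂ then 1 else 0)) :
    (kW : ℤ) = (c₁ + c₂ - cW + cV) + kV + ((n₁ + n₂ : ℕ) : ℤ) + (if r₁ ∨ r₂ then 1 else 0) := by
  by_cases h₁ : r₁ <;> by_cases h₂ : r₂ <;> simp only [h₁, h₂, and_self, and_true, and_false, true_and, false_and, or_self,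
    or_true, or_false, true_or, false_or, if_true, if_false] at eV e₁ e₂ ⊢ <;> push_cast <;> omega

/-! ### Half-edges: membership, separation, splitting -/

/-- A vertex of a half-edge of `A`-upper / `B`-lower type is an upper face or subdivision point of `A`, or a subdivision point or
lower face of `B`. [folklore] -/
theorem mem_dualEdges (φ ψ : Sym2 V → Finset (Sym2 V)) {A B : Finset (Sym2 V)} {x : Sym2 (Finset (Sym2 V) ⊕ Sym2 V)}
    (hx : x ∈ A.image (fun e => s(Sum.inl (φ e), Sum.inr e)) ∪ B.image (fun e => s(Sum.inr e, Sum.inl (ψ e)))) {z : Finset (Sym2 V) ⊕ Sym2 V} (hz : z ∈ x) :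
    (∃ e ∈ A, z = Sum.inl (φ e) ∨ z = Sum.inr e) ∨ (∃ e ∈ B, z = Sum.inr e ∨ z = Sum.inl (ψ e)) := by
  rcases Finset.mem_union.1 hx with h | h
  · obtain ⟨e, he, rfl⟩ := Finset.mem_image.1 h
    exact Or.inl ⟨e, he, Sym2.mem_iff.1 hz⟩
  · obtain ⟨e, he, rfl⟩ := Finset.mem_image.1 h
    exact Or.inr ⟨e, he, Sym2.mem_iff.1 hz⟩

/-- Half-edges over DISJOINT edge sets are distinct (each half-edge carries the subdivision point of its own edge). [folklore] -/
theorem disjoint_dualEdges (φ₁ ψ₁ φ₂ ψ₂ : Sym2 V → Finset (Sym2 V)) {A₁ B₁ A₂ B₂ : Finset (Sym2 V)} (h : Disjoint (A₁ ∪ B₁) (A₂ ∪ B₂)) :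
    Disjoint (A₁.image (fun e => s(Sum.inl (φ₁ e), Sum.inr e)) ∪ B₁.image (fun e => s(Sum.inr e, Sum.inl (ψ₁ e)))) (A₂.image (fun e => s(Sum.inl (φ₂ e)
        , Sum.inr e)) ∪ B₂.image (fun e => s(Sum.inr e, Sum.inl (ψ₂ e)))) := by
  rw [Finset.disjoint_left]
  intro x hx₁ hx₂
  -- the subdivision point carried by `x`, read in both families
  have key : ∀ e, (Sum.inr e : Finset (Sym2 V) ⊕ Sym2 V) ∈ x → e ∈ A₁ ∪ B₁ → False := by
    intro e he he₁
    rcases mem_dualEdges φ₂ ψ₂ hx₂ he with ⟨e', he', h' | h'⟩ | ⟨e', he', h' | h'⟩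
    · exact Sum.inr_ne_inl h'
    · exact Finset.disjoint_left.1 h he₁ (Finset.mem_union_left _ ((Sum.inr_injective h').symm ▸ he'))
    · exact Finset.disjoint_left.1 h he₁ (Finset.mem_union_right _ ((Sum.inr_injective h').symm ▸ he'))
    · exact Sum.inr_ne_inl h'
  rcases Finset.mem_union.1 hx₁ with h₁ | h₁
  · obtain ⟨e, he, rfl⟩ := Finset.mem_image.1 h₁
    exact key e (Sym2.mem_mk_right _ _) (Finset.mem_union_left _ he)
  · obtain ⟨e, he, rfl⟩ := Finset.mem_image.1 h₁
    exact key e (Sym2.mem_mk_left _ _) (Finset.mem_union_right _ he)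

/-- Every vertex of a dual configuration over `E` with terminal labels `U, D` is `inl U`, `inl D`, the label of a nonempty subset of
`E`, or a subdivision point of `E`. [folklore] -/
theorem dual_vertex_cases {φ ψ : Sym2 V → Finset (Sym2 V)} {E U D A B : Finset (Sym2 V)}
    (hR : ∀ e ∈ E, (φ e = U ∨ φ e = D ∨ (φ e ⊆ E ∧ (φ e).Nonempty)) ∧ (ψ e = U ∨ ψ e = D ∨ (ψ e ⊆ E ∧ (ψ e).Nonempty)))
    (hA : A ⊆ E) (hB : B ⊆ E) {x : Sym2 (Finset (Sym2 V) ⊕ Sym2 V)} (hx : x ∈ A.image (fun e => s(Sum.inl (φ e), Sum.inr e)) ∪ B.image (fun e => s(Sum.inr e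
        , Sum.inl (ψ e))))
    {z : Finset (Sym2 V) ⊕ Sym2 V} (hz : z ∈ x) :
    z = Sum.inl U ∨ z = Sum.inl D ∨ (∃ T : Finset (Sym2 V), T ⊆ E ∧ T.Nonempty ∧ z = Sum.inl T) ∨ (∃ e ∈ E, z = Sum.inr e) := by
  rcases mem_dualEdges φ ψ hx hz with ⟨e, he, rfl | rfl⟩ | ⟨e, he, rfl | rfl⟩
  · rcases (hR e (hA he)).1 with h | h | h
    · exact Or.inl (by rw [h])
    · exact Or.inr (Or.inl (by rw [h]))
    · exact Or.inr (Or.inr (Or.inl ⟨φ e, h.1, h.2, rfl⟩))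
  · exact Or.inr (Or.inr (Or.inr ⟨e, hA he, rfl⟩))
  · exact Or.inr (Or.inr (Or.inr ⟨e, hB he, rfl⟩))
  · rcases (hR e (hB he)).2 with h | h | h
    · exact Or.inl (by rw [h])
    · exact Or.inr (Or.inl (by rw [h]))
    · exact Or.inr (Or.inr (Or.inl ⟨ψ e, h.1, h.2, rfl⟩))

/-- **Separation of two dual parts.**  Over disjoint `E₁, E₂`, with labels `(U₁, D₁)`, `(U₂, D₂)` such that no label of one part is
a nonempty subset of the other part, a common vertex of the two dual edge sets is a terminal label of BOTH parts. [folklore] -/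
theorem dual_common_vertex {φ₁ ψ₁ φ₂ ψ₂ : Sym2 V → Finset (Sym2 V)} {E₁ E₂ U₁ D₁ U₂ D₂ : Finset (Sym2 V)} (hd : Disjoint E₁ E₂)
    (R₁ : ∀ e ∈ E₁, (φ₁ e = U₁ ∨ φ₁ e = D₁ ∨ (φ₁ e ⊆ E₁ ∧ (φ₁ e).Nonempty)) ∧ (ψ₁ e = U₁ ∨ ψ₁ e = D₁ ∨ (ψ₁ e ⊆ E₁ ∧ (ψ₁ e).Nonempty)))
    (R₂ : ∀ e ∈ E₂, (φ₂ e = U₂ ∨ φ₂ e = D₂ ∨ (φ₂ e ⊆ E₂ ∧ (φ₂ e).Nonempty)) ∧ (ψ₂ e = U₂ ∨ ψ₂ e = D₂ ∨ (ψ₂ e ⊆ E₂ ∧ (ψ₂ e).Nonempty)))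
    (hU₁ : ¬ (U₁ ⊆ E₂ ∧ U₁.Nonempty)) (hD₁ : ¬ (D₁ ⊆ E₂ ∧ D₁.Nonempty)) (hU₂ : ¬ (U₂ ⊆ E₁ ∧ U₂.Nonempty))
    (hD₂ : ¬ (D₂ ⊆ E₁ ∧ D₂.Nonempty)) {z : Finset (Sym2 V) ⊕ Sym2 V}
    (h₁ : ∃ x ∈ E₁.image (fun e => s(Sum.inl (φ₁ e), Sum.inr e)) ∪ E₁.image (fun e => s(Sum.inr e, Sum.inl (ψ₁ e))), z ∈ x) (h₂ : ∃ x ∈ E₂.image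
        (fun e => s(Sum.inl (φ₂ e), Sum.inr e)) ∪ E₂.image (fun e => s(Sum.inr e, Sum.inl (ψ₂ e))), z ∈ x) :
    (z = Sum.inl U₁ ∨ z = Sum.inl D₁) ∧ (z = Sum.inl U₂ ∨ z = Sum.inl D₂) := by
  obtain ⟨x₁, hx₁, hz₁⟩ := h₁
  obtain ⟨x₂, hx₂, hz₂⟩ := h₂
  have c₁ := dual_vertex_cases R₁ subset_rfl subset_rfl hx₁ hz₁
  have c₂ := dual_vertex_cases R₂ subset_rfl subset_rfl hx₂ hz₂
  rcases c₁ with h | h | ⟨T, hTE, hTn, rfl⟩ | ⟨e, he, rfl⟩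
  · rcases c₂ with h' | h' | ⟨T', hT'E, hT'n, rfl⟩ | ⟨e', _, rfl⟩
    · exact ⟨Or.inl h, Or.inl h'⟩
    · exact ⟨Or.inl h, Or.inr h'⟩
    · exact absurd ⟨(Sum.inl_injective h) ▸ hT'E, (Sum.inl_injective h) ▸ hT'n⟩ hU₁
    · exact absurd h Sum.inr_ne_inl
  · rcases c₂ with h' | h' | ⟨T', hT'E, hT'n, rfl⟩ | ⟨e', _, rfl⟩
    · exact ⟨Or.inr h, Or.inl h'⟩
    · exact ⟨Or.inr h, Or.inr h'⟩
    · exact absurd ⟨(Sum.inl_injective h) ▸ hT'E, (Sum.inl_injective h) ▸ hT'n⟩ hD₁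
    · exact absurd h Sum.inr_ne_inl
  · rcases c₂ with h' | h' | ⟨T', hT'E, _, h'⟩ | ⟨e', _, h'⟩
    · exact absurd ⟨(Sum.inl_injective h').symm ▸ hTE, (Sum.inl_injective h').symm ▸ hTn⟩ hU₂
    · exact absurd ⟨(Sum.inl_injective h').symm ▸ hTE, (Sum.inl_injective h').symm ▸ hTn⟩ hD₂
    · obtain ⟨y, hy⟩ := hTn
      exact absurd (hT'E ((Sum.inl_injective h') ▸ hy)) (Finset.disjoint_left.1 hd (hTE hy))
    · exact absurd h' Sum.inl_ne_inr
  · rcases c₂ with h' | h' | ⟨T', _, _, h'⟩ | ⟨e', he', h'⟩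
    · exact absurd h' Sum.inr_ne_inl
    · exact absurd h' Sum.inr_ne_inl
    · exact absurd h' Sum.inr_ne_inl
    · exact absurd ((Sum.inr_injective h').symm ▸ he') (Finset.disjoint_left.1 hd he)

/-- A label that is not a terminal label of a part and not a nonempty subset of it is off every half-edge of that part. [folklore] -/
theorem inl_not_mem_dualEdges {φ ψ : Sym2 V → Finset (Sym2 V)} {E U D F : Finset (Sym2 V)}
    (hR : ∀ e ∈ E, (φ e = U ∨ φ e = D ∨ (φ e ⊆ E ∧ (φ e).Nonempty)) ∧ (ψ e = U ∨ ψ e = D ∨ (ψ e ⊆ E ∧ (ψ e).Nonempty)))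
    (hFU : F ≠ U) (hFD : F ≠ D) (hF : ¬ (F ⊆ E ∧ F.Nonempty)) :
    ∀ x ∈ E.image (fun e => s(Sum.inl (φ e), Sum.inr e)) ∪ E.image (fun e => s(Sum.inr e, Sum.inl (ψ e))), (Sum.inl F : Finset (Sym2 V) ⊕ Sym2 V) ∉ x := by
  intro x hx hz
  rcases dual_vertex_cases hR subset_rfl subset_rfl hx hz with h | h | ⟨T, hTE, hTn, h⟩ | ⟨e, _, h⟩
  · exact hFU (Sum.inl_injective h)
  · exact hFD (Sum.inl_injective h)
  · exact hF ⟨(Sum.inl_injective h).symm ▸ hTE, (Sum.inl_injective h).symm ▸ hTn⟩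
  · exact Sum.inl_ne_inr h

/-- Splitting a dual configuration of `E₁ ∪ E₂` built from the COMBINED face maps along the parts. [folklore] -/
theorem dual_split (φ₁ ψ₁ φ₂ ψ₂ : Sym2 V → Finset (Sym2 V)) {E₁ E₂ : Finset (Sym2 V)} (hd : Disjoint E₁ E₂)
    (A : Finset (Sym2 V)) (hA : A ⊆ E₁ ∪ E₂) :
    A.image (fun e => s(Sum.inl (if e ∈ E₁ then φ₁ e else φ₂ e), Sum.inr e)) ∪ (E₁ ∪ E₂).image (fun e => s(Sum.inr e, Sum.inl (if e ∈ E₁ then ψ₁ e else ψ₂ e))) =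
      ((A ∩ E₁).image (fun e => s(Sum.inl (φ₁ e), Sum.inr e)) ∪ E₁.image (fun e => s(Sum.inr e, Sum.inl (ψ₁ e)))) ∪ ((A ∩ E₂).image (fun e => s(Sum.inl (φ₂ e)
          , Sum.inr e)) ∪ E₂.image (fun e => s(Sum.inr e, Sum.inl (ψ₂ e)))) := by
  have hA' : A ∩ E₁ ∪ A ∩ E₂ = A := by rw [← Finset.inter_union_distrib_left, Finset.inter_eq_left.2 hA]
  have u₁ : (A ∩ E₁).image (fun e => s(Sum.inl (if e ∈ E₁ then φ₁ e else φ₂ e), Sum.inr e)) = (A ∩ E₁).image (fun e => s(Sum.inl (φ₁ e), Sum.inr e)) :=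
    Finset.image_congr fun e he => by simp only [if_pos (Finset.mem_inter.1 he).2]
  have u₂ : (A ∩ E₂).image (fun e => s(Sum.inl (if e ∈ E₁ then φ₁ e else φ₂ e), Sum.inr e)) = (A ∩ E₂).image (fun e => s(Sum.inl (φ₂ e), Sum.inr e)) :=
    Finset.image_congr fun e he => by simp only [if_neg (Finset.disjoint_right.1 hd (Finset.mem_inter.1 he).2)]
  have l₁ : E₁.image (fun e => s(Sum.inr e, Sum.inl (if e ∈ E₁ then ψ₁ e else ψ₂ e))) = E₁.image (fun e => s(Sum.inr e, Sum.inl (ψ₁ e))) :=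
    Finset.image_congr fun e he => by simp only [if_pos (Finset.mem_coe.1 he)]
  have l₂ : E₂.image (fun e => s(Sum.inr e, Sum.inl (if e ∈ E₁ then ψ₁ e else ψ₂ e))) = E₂.image (fun e => s(Sum.inr e, Sum.inl (ψ₂ e))) :=
    Finset.image_congr fun e he => by simp only [if_neg (Finset.disjoint_right.1 hd (Finset.mem_coe.1 he))]
  nth_rewrite 1 [← hA']
  rw [Finset.image_union, Finset.image_union, u₁, u₂, l₁, l₂, Finset.union_union_union_comm]

/-- The two intersections of a split configuration. [folklore] -/
theorem sdiff_union_inter {E₁ E₂ ω₁ ω₂ : Finset (Sym2 V)} (hd : Disjoint E₁ E₂) (hω₁ : ω₁ ⊆ E₁) (hω₂ : ω₂ ⊆ E₂) :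
    ((E₁ ∪ E₂) \ (ω₁ ∪ ω₂)) ∩ E₁ = E₁ \ ω₁ ∧ ((E₁ ∪ E₂) \ (ω₁ ∪ ω₂)) ∩ E₂ = E₂ \ ω₂ := by
  constructor
  · ext e
    simp only [Finset.mem_inter, Finset.mem_sdiff, Finset.mem_union, not_or]
    exact ⟨fun h => ⟨h.2, h.1.2.1⟩, fun h => ⟨⟨Or.inl h.1, h.2, fun h2 => Finset.disjoint_left.1 hd h.1 (hω₂ h2)⟩, h.1⟩⟩
  · ext e
    simp only [Finset.mem_inter, Finset.mem_sdiff, Finset.mem_union, not_or]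
    exact ⟨fun h => ⟨h.2, h.1.2.2⟩, fun h => ⟨⟨Or.inr h.1, fun h1 => Finset.disjoint_left.1 hd (hω₁ h1) h.1, h.2⟩, h.1⟩⟩

end FK

end Summit.CriticalPhenomena.PercolationContinuityZ3.Theorems

end
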